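import Literature.MathematicalPhysics.QuantumFieldTheory.Balaban1983to89.B6Prop26KLevelAssemblyV1L0
import Literature.MathematicalPhysics.QuantumFieldTheory.Balaban1983to89.B6Prop26KLevelAssemblyV1L3
import Literature.MathematicalPhysics.QuantumFieldTheory.Balaban1983to89.B6CubeMoutV1L0
import Literature.MathematicalPhysics.QuantumFieldTheory.Balaban1983to89.B6CubeMoutV1L3
/-!
# `Balaban1983to89.B6Prop26KLevelAssemblyV1PerCubeL3` — RE-CENTRED-WINDOW TWIN (sub-row G-F3′-L0∕L3 of programme G-F3′-L0; UV3-NODE §26.3 (P2-L3); every odd `L ≥ 3`;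
ruling of record `lit-balaban-r03/G-F3L0-PLAN.md` v1.5 §13 (B′), joints J9′–J11′, J14) of `B6Prop26KLevelAssemblyV1PerCubeL0`: the SAME declarations, names and
statements over p21's re-centred root `B6CubeWindowV1L3` (window corner `x0C = S_j·(qc − ℓ) = ctr − (2L−1)S_j/2` — the cube's central block is
the middle block of its `2L`-block member torus, print p.238 «□ in the middle of □̃³ = T_□»; reach sub-window corner `x1C = x0C + (L−2)S_j`;
`PlacedC`; `eC`, `ρ`, `R ≥ 2L²`, `C = 9`, `M_c = 8S/3` UNCHANGED; the binder `(4 ≤ ℓ)` DROPPED).  J14: ONLY the window-dependent declarations are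
re-declared here; every window-free declaration of the L0 twin and every `D`-free object of the lineage is consumed BY NAME.  No existing module is
touched; no fact is minted; standard axioms.  Unit `lit-balaban-p33` (gen 90), 2026-08-27.  THE TWIN'S DOCUMENTATION FOLLOWS VERBATIM (its
«x₀ = ctr − L·S_j/2» / «L ≥ 5» sentences describe the twin; here the anchor is `(2L−1)S_j/2` and L ≥ 3; the twin's `…_L5` conveniences
(L = 5, P′ ≥ 12, `placed_all_cubes`) become `…_L3` ones (L = 3, P′ ≥ 6) through p21's `B6CubeWindowV1L3.placedC_all_cubes (ℓ = 2) (6 ≤ P′)`).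

statement-level skeleton of published theorems with citation tags; proofs where landed; nothing here is a claim about the Yang–Mills mass gap

# `Balaban1983to89.B6Prop26KLevelAssemblyV1PerCubeL0` — LEVEL-0 TWIN (programme G-F3′-L0, director-ym LINE №27 / UV3-NODE §24.5; plan `lit-balaban-r03/G-F3L0-PLAN.md`) of `B6Prop26KLevelAssemblyV1PerCube`:
the same declarations, SAME NAMES AND STATEMENTS, for nested families WITH print's region `Λ₀ = T ∖ Ω₁` ADMITTED (structures
`B6MultiLevelBoxOperatorL0.Domains` / `B6MultiLevelTorusOperatorL0.TDomains`: levels `0, …, k`, the level-`0` block a single site, `Q′₀ = id`,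
finite weight `a₀` — print p.225 (2.14) «Σ_{j=0}^k … (Q′₀λ)(x) = λ(x), x ∈ Λ₀», p.229 «taking a sequence (2.1) … smallest possible domains B^j(Λ_j),
and considering the operator Δ_a defined by (2.19), (2.20) for this sequence»).  Every `D`-free object is the lineage's, consumed BY NAME; no existing
module is touched; no fact is minted.  Unit `lit-balaban-p33` (p33 gen 89; S-E entry twins named to p33 by the B6 owner r03 gen 36, ruling 2026-08-27T18:45:57Z; port tooling by r03 gen 36); B6 fold owner r03; referee ref-4.  LEVEL-0 JOINT J8 is ABSORBED here (B6 owner r03 gen 36, 2026-08-27T20:22:40Z): the witness `M₁` of `prop26_2136_kLevel_assembly_line3` is enlarged to `max M₁ (2L²)` inside the proof and `2L ≤ M_h` is derived there for `B6CubeCoeffSizesV1L3.abs_cfC_le`; both STATEMENTS are the twin's verbatim.  THE TWIN'S DOCUMENTATION FOLLOWS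
VERBATIM (its «levels 1 … k» / «Ω₁ = X» sentences describe the twin; here `j` runs from `0` and `Ω₁` may be a proper subset).

# `Balaban1983to89.B6Prop26KLevelAssemblyV1PerCube` — T. Bałaban, *Propagators and renormalization transformations for lattice gauge theories. II*,
# Commun. Math. Phys. **96** (1984) 223–250 [Balaban1984PropagatorsII], Prop. 2.6 (2.136)₁ p. 247 for the GENUINE `k`-level `G = Δ_a⁻¹` on the V1
# torus: r03's assembly `…B6Prop26KLevelAssemblyV1L3.prop26_2136_kLevel_assembly_nbig` WITH THE TWO p38 PER-CUBE INPUTS DISCHARGED BY NAME —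
# (ii) the output localisation `OutLoc (M_□h_□) □̃` (`…B6CubeMoutV1L3.outLoc_Ml_hB'`) and (iii) the sizes and supports of the line-1 coefficients
# `c_e = s(□)·E_eh_□`, `c₀ = s(□)·Δh_□` (`…B6CubeCoeffSizesV1L3.abs_cfC_le` / `cfC_supp` / `abs_c0C_le` / `c0C_supp`, `s₁ = C1F·L³`, `s₂ = (d+1)·C2F·L`)

statement-level skeleton of published theorems with citation tags; proofs where landed; nothing here is a claim about the Yang–Mills mass gap

PDF held: `paper:balaban1984-cmp96-propagators-rt-ii` (journal page = PDF page + 222): p. 247 [PDF 25] ((2.133)–(2.136), Prop. 2.6; *"|∂h_□| ≤ O(1)(ML^jη)^{−1}, |Δh_□| ≤ O(1)M^{−1}(L^jη)^{−2}"*), p. 239 [PDF 17] ((2.89)–(2.94); ζ_□ *"equal to 1 on a cube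
containing □ … equal to 0 outside a similar cube"* — the supports of h_□, ζ_□ in □̃ are our paraphrase of this, NOT a printed sentence: v1.1 DOCFIX per ref-4
D-g67-1, v1 had «these functions have supports in □̃» in quotation marks; Lean content unchanged); read from the tree transcriptions in the
imported modules.

CITATION HEADER (lean-in-tree rule) — WHAT IS REPRODUCED.  Phase-2 file of the `lit-balaban` typed skeleton (HOME `run/shared/lean/pub/lit-balaban/`), seat
**p38 gen 29** (literature-prover-lit-balaban-p38-g29-0) for the row owner r03 (B6.Prop2.6; referee ref-4).  SKELETON rows **B6.Prop2.6** × **B6.Eq2.134** ×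
B6.Eq2.92 × B6.Eq2.36 (cells only; decls of record untouched).  IMPORTS BY NAME, restating nothing: `…B6Prop26KLevelAssemblyV1` (r03 g21:
`prop26_2136_kLevel_assembly_nbig`, its `L = 5` twin is re-derived here from the general one), `…B6CubeMoutV1` (p38 g28: `outLoc_Ml_hB'`),
`…B6CubeCoeffSizesV1` (p38 g27–28: `abs_cfC_le`, `cfC_supp`, `abs_c0C_le`, `c0C_supp`, `s1C_nonneg`, `s2C_nonneg`), `…B6CubeWindowV1` (r03: `PlacedC`,
`placedC_all_cubes`, `Pl`, `GlobalBand`).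

## WHAT THIS FILE CERTIFIES (kernel-checked, 0 sorry, standard axioms; THEOREMS ONLY — no `def`, no `def … : Prop`, no new named fact)

* **`prop26_2136_kLevel_assembly_line3`** — PROPOSITION 2.6, ENTRY (2.136)₁, FOR THE GENUINE k-LEVEL `G` ON THE V1 TORUS with, of r03's four displayed
  per-cube inputs, ONLY THE LINE-3 MAJORANT (iv) LEFT: for the weight band `[b₀, b₁]` there is `σ > 0` such that for every Lemma-2.1 budget `(α, N₀)` and
  line-3 constants `C_D ≥ 0`, `c_D > 0` there are `A ≥ 0`, `M₁ > 0` with — on every admissible V1 torus (`k ≥ 2`, `M_h = L^a ≥ 8`, `R ≥ 2L²`, `P′ ≥ 5`,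
  `L ≥ 5`, all cubes placed, `L·M_h ≥ M₁`, `N₀ + 1 ≤ R·L·M_h`, the (2.59)-shape threshold at rate `σ`), for `c′ ≠ 0` and weights in the global band,
  GIVEN the line-3 majorant `HasMajorant (ζ_□(∂(1−R)∂* − P_□)h_□) (C_D c′² e^{−c_D M}/len²·e^{−2σ d_T})` for every cube —
  `HasMajorant (geomT D) (blkV1 hN D) G (A·(L^{j(y)}/c′)²·e^{−delta3 α (2σ)·d_T(y,y′)})`.
  Inside: (i) `Nbig = 3·9^{d+1}` (r03's `_nbig`), (ii) `outLoc_Ml_hB'`, (iii) `abs_cfC_le`/`cfC_supp`/`abs_c0C_le`/`c0C_supp` with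
  `s₁ := C1F d ℓ·(ℓ+1)³`, `s₂ := (d+1)·C2F d ℓ·(ℓ+1)` (both `c′`-free, as the assembly's rescaling requires).
* **`prop26_2136_kLevel_assembly_L5_line3`** — the same at `L = 5` (`ℓ = 4`), `P′_μ ≥ 12`, where the canonical chart places every cube
  (`placedC_all_cubes`): no geometric hypothesis on the cubes left; displayed = line 3 + the Lemma-2.1 budget.

## HONEST SCOPE / DIVERGENCES

(1) What stays displayed: the line-3 majorant (iv) of `ζ_□(∂(1−R)∂* − P_□)h_□` (the by-parts route: p38 `line3P_hasMajorant_gk_zone_cut` + p22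
`B6Line3WindowV1.line3_window` + the cube's χ/zone data — in progress, p22 g20 / r03 g21) and the Lemma-2.1 budget `(α, N₀)` with its threshold; the
placement of the top cubes for general `L` (`PlacedC`; automatic at `L = 5`, `P′ ≥ 12`).  (2) As the assembly: `L ≥ 5`, `M_h = L^a ≥ 8`, `R ≥ 2L²`,
`P′ ≥ 5`, `k ≥ 2`; constants `A`, `M₁` on `d, L, b₀, b₁, α, N₀, C_D, c_D` only (uniform in `k`, `M_h`, `m`, `K`, `c′`).  (3) Entries (2.136)₂₋₄ /
(2.137)–(2.140) untouched; integer torus, lattice units; nothing on d = 4 or the continuum; value = two displayed hypotheses of the k-level (2.136)₁ removed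
by landed theorems; NOT summit progress.  Unit `lit-balaban-p38` (gen 29), 2026-08-23.
-/

open scoped BigOperators
open Finset

namespace Literature.MathematicalPhysics.QuantumFieldTheory.Balaban1983to89.B6Prop26KLevelAssemblyV1PerCubeL3

open B4Reflection242 (boxDom)
open B6MultiLevelBoxOperator (N0)
open B6MultiLevelTorusOperatorL0 (TDomains)
open B6Cover236MultiLevelBlocksL0 (cubes)
open B6Geom246MultiLevelTorusL0 (geomT)
open B8Ineq192MultiLevelTorusL0 (geomTB)
open B6RandomWalk (HasMajorant delta3)
open B6Prop26Gluing (mulOp)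
open B6Ineq2133TwoScaleV1 (onFun)
open B6GlobalChartV1 (PV)
open B6GlobalChartV1L0 (domT blkV1)
open B6SectAOperatorsV1 (dE dsE RE BondIdx)
open B6SectAVectorModelV1 (GE)
open B6Prop26KLevelSkeletonV1L0 (hB zB pref)
open B6CubeWindowV1 (GlobalBand band_le one_le_of_eight_le four_le_of_five_le)
open B6CubeWindowV1L3 (PlacedC)
open B6CubeWindowV1L3 (Pl placedC_all_cubes)
open B6CubeCoeffSizesV1 (s1C_nonneg s2C_nonneg)
open B6CubeCoeffSizesV1L3 (abs_cfC_le cfC_supp abs_c0C_le c0C_supp)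
open B6CubeMoutV1L3 (outLoc_Ml_hB')
open B6Prop26KLevelAssemblyV1L3 (prop26_2136_kLevel_assembly_nbig)

noncomputable section

variable {d ℓ : ℕ} {hd : 1 ≤ d + 1} {hL : Odd (ℓ + 1) ∧ 1 < ℓ + 1} {m K : ℕ} {Mh k R : ℕ} {P' : Fin (d + 1) → ℕ}

/-! ## §1  The k-level (2.136)₁ with (ii) `hMout` and (iii) the line-1 sizes/supports discharged -/

/-- `max M (2L²) ≤ L·M_h` gives the level-0 joint `2L ≤ M_h` (J8 absorbed into the threshold). [cite: Balaban1984PropagatorsII, (2.2) p.224, bookkeeping] -/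
private theorem hMhL_of_max_le {ℓ Mh : ℕ} {M : ℝ} (h : max M (2 * ((ℓ : ℝ) + 1) ^ 2) ≤ ((ℓ : ℝ) + 1) * Mh) : 2 * (ℓ + 1) ≤ Mh := by
  have h2 : 2 * ((ℓ : ℝ) + 1) ^ 2 ≤ ((ℓ : ℝ) + 1) * Mh := (le_max_right _ _).trans h
  have hL : (0 : ℝ) < (ℓ : ℝ) + 1 := by positivity
  have h3 : ((2 * (ℓ + 1) : ℕ) : ℝ) ≤ (Mh : ℝ) := by push_cast; nlinarith
  exact_mod_cast h3

section Line3

open Classical in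
/-- **PROPOSITION 2.6, ENTRY (2.136)₁, FOR THE GENUINE k-LEVEL `G = Δ_a⁻¹` ON THE V1 TORUS — ONLY LINE 3 DISPLAYED.**  r03's
`prop26_2136_kLevel_assembly_nbig` with hypothesis (ii) fed by `B6CubeMoutV1L3.outLoc_Ml_hB'` (the local operator `M_□` applied after `h_□` has outputs on the
blocks of `□̃`: Δ-part bond range one step, `Q*a_□Q` under one member index bond, supports in □̃ — paraphrase of p. 239, cf. header) and hypotheses (iii) fed by
`B6CubeCoeffSizesV1L3.abs_cfC_le`/`cfC_supp`/`abs_c0C_le`/`c0C_supp` (p. 247 *"|∂h_□| ≤ O(1)(ML^jη)^{−1}, |Δh_□| ≤ O(1)M^{−1}(L^jη)^{−2}"* with supports over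
`□⁺`; `s₁ = C1F·L³`, `s₂ = (d+1)·C2F·L`).  For the weight band `[b₀, b₁]` there is `σ > 0`; for every budget `α ∈ [0,1]`, `N₀ ≥ 1` and line-3 constants
`C_D ≥ 0`, `c_D > 0` there are `A ≥ 0`, `M₁ > 0` such that on every admissible V1 torus, GIVEN the line-3 majorant of `ζ_□(∂(1−R)∂* − P_□)h_□` at rate `2σ`
for every cube, `|G(x,x′)| ≤ A·(L^{j(y)}/c′)²·e^{−δ₃ d_T(y,y′)}` blockwise, `δ₃ = delta3 α (2σ)`.
[cite: Balaban1984PropagatorsII, Prop. 2.6 (2.136) p.247, (2.133)–(2.135) p.247, (2.88)–(2.94) pp.238–239, (2.36) p.229, Lemma 2.1 p.234] -/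
theorem prop26_2136_kLevel_assembly_line3 (d ℓ : ℕ) (hd : 1 ≤ d + 1) (hL : Odd (ℓ + 1) ∧ 1 < ℓ + 1) {b₀ b₁ : ℝ} (hb₀ : 0 < b₀) (hb₁ : b₀ ≤ b₁) :
    ∃ σ : ℝ, 0 < σ ∧ ∀ (α : ℝ), 0 ≤ α → α ≤ 1 → ∀ (N₀ : ℕ), 0 < N₀ → ∀ {CD cD : ℝ}, 0 ≤ CD → 0 < cD →
    ∃ A M₁ : ℝ, 0 ≤ A ∧ 0 < M₁ ∧
    ∀ (m K : ℕ) {Mh k R : ℕ} {P' : Fin (d + 1) → ℕ}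
      (hN : ∀ μ, N0 ℓ Mh k P' μ = (PV d ℓ m K hd hL).sitesPerDir 0) (D : B6MultiLevelTorusOperatorL0.TDomains d ℓ Mh k P' R) (hk : k ≤ m + K) (_ : 2 ≤ k)
      {a : ℕ} (hMha : Mh = (ℓ + 1) ^ a) (hM8 : 8 ≤ Mh) (_ : 2 * (ℓ + 1) ^ 2 ≤ R) (hP5 : ∀ μ, 5 ≤ P' μ)
      (hpl : ∀ c : ↥(cubes D.toDomains), PlacedC ℓ k P' c.1)
      (_ : M₁ ≤ ((ℓ : ℝ) + 1) * Mh) (_ : N₀ + 1 ≤ R * ((ℓ + 1) * Mh))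
      (_ : Real.exp (-(α * σ)) * ((ℓ : ℝ) + 1) ^ ((2 * (d + 1 : ℕ) : ℝ) / N₀) < 1)
      {cf : ℝ} (hcf : cf ≠ 0) {w : BondIdx (domT hN D hk) → ℝ} (hw : ∀ i, 0 < w i) (_ : GlobalBand b₀ b₁ cf w)
      -- line 3 (p38/p22), the only per-cube input left
      (_ : ∀ c : ↥(cubes D.toDomains), HasMajorant (g := geomTB D) (blkV1 hN D)
        (mulOp (zB hN D (one_le_of_eight_le hM8) (four_le_of_five_le hP5) c) *
          (onFun (dE (P := PV d ℓ m K hd hL) cf ∘ₗ (LinearMap.id - RE (domT hN D hk) cf) ∘ₗ dsE cf) -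
            Pl hN hk (one_le_of_eight_le hM8) (four_le_of_five_le hP5) hMha c (band_le (d := d) (ℓ := ℓ) hb₀ hb₁) (hpl c) w cf) *
          mulOp (hB hN D c))
        (fun y y'' => CD * cf ^ 2 * Real.exp (-(cD * (geomTB D).M)) / (geomTB D).len y ^ 2 * Real.exp (-((2 * σ) * (geomTB D).dist y y'')))),
      HasMajorant (g := geomT D) (blkV1 hN D) (onFun (GE (domT hN D hk) hcf hw))
        (fun y y' => A * pref cf y * Real.exp (-(delta3 α (2 * σ) * (geomT D).dist y y'))) := by
  obtain ⟨σ, hσ, h⟩ := prop26_2136_kLevel_assembly_nbig d ℓ hd hL hb₀ hb₁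
  refine ⟨σ, hσ, fun α hα0 hα1 N₀ hN₀ CD cD hCD hcD => ?_⟩
  obtain ⟨A, M₁, hA, hM₁, h2⟩ := h α hα0 hα1 N₀ hN₀ (s1C_nonneg d ℓ) (s2C_nonneg d ℓ) hCD hcD
  -- LEVEL-0 JOINT J8 ABSORBED (r03 ruling 2026-08-27T20:22:40Z): the threshold is enlarged to `max M₁ (2L²)` so that `2L ≤ M_h` is available
  -- for `B6CubeCoeffSizesV1L3.abs_cfC_le` (the fine-step size at level 0); the STATEMENT is the twin's verbatim.
  refine ⟨A, max M₁ (2 * ((ℓ : ℝ) + 1) ^ 2), hA, lt_max_of_lt_left hM₁, ?_⟩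
  intro m K Mh k R P' hN D hk hk2 a hMha hM8 hR2 hP5 hpl hLM hRM hθ cf hcf w hw hwb hD3
  have hLM1 : M₁ ≤ ((ℓ : ℝ) + 1) * Mh := (le_max_left _ _).trans hLM
  have hMhL : 2 * (ℓ + 1) ≤ Mh := hMhL_of_max_le hLM
  exact h2 m K hN D hk hk2 hMha hM8 hR2 hP5 hpl hLM1 hRM hθ hcf hw hwb
    (fun c => outLoc_Ml_hB' hN hk (one_le_of_eight_le hM8) (four_le_of_five_le hP5) hMha c (band_le (d := d) (ℓ := ℓ) hb₀ hb₁)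
      hM8 hR2 hP5 (hpl c) w cf)
    (fun c e x => abs_cfC_le hN hk (one_le_of_eight_le hM8) (four_le_of_five_le hP5) hMha c (band_le (d := d) (ℓ := ℓ) hb₀ hb₁)
      hM8 hMhL hR2 hP5 (hpl c) w cf e x)
    (fun c e x hx => cfC_supp hN hk (one_le_of_eight_le hM8) (four_le_of_five_le hP5) hMha c (band_le (d := d) (ℓ := ℓ) hb₀ hb₁)
      hM8 hR2 hP5 (hpl c) w cf e x hx)
    (fun c x => abs_c0C_le hN hk (one_le_of_eight_le hM8) (four_le_of_five_le hP5) hMha c (band_le (d := d) (ℓ := ℓ) hb₀ hb₁)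
      hM8 hR2 hP5 (hpl c) w cf x)
    (fun c x hx => c0C_supp hN hk (one_le_of_eight_le hM8) (four_le_of_five_le hP5) hMha c (band_le (d := d) (ℓ := ℓ) hb₀ hb₁)
      hM8 hR2 hP5 (hpl c) w cf x hx)
    hD3

open Classical in
/-- **THE SAME AT `L = 3` (`ℓ = 2`), `P′_μ ≥ 6`** — the canonical index-`2` chart places every cube (`B6CubeWindowV1L3.placedC_all_cubes`), so NO geometric
per-cube hypothesis is left: displayed = the line-3 majorant + the Lemma-2.1 budget. [cite: Balaban1984PropagatorsII, Prop. 2.6 (2.136) p.247, (2.36) p.229, p.235, p.247] -/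
theorem prop26_2136_kLevel_assembly_L3_line3 (d : ℕ) (hd : 1 ≤ d + 1) (hL : Odd (2 + 1) ∧ 1 < 2 + 1) {b₀ b₁ : ℝ} (hb₀ : 0 < b₀) (hb₁ : b₀ ≤ b₁) :
    ∃ σ : ℝ, 0 < σ ∧ ∀ (α : ℝ), 0 ≤ α → α ≤ 1 → ∀ (N₀ : ℕ), 0 < N₀ → ∀ {CD cD : ℝ}, 0 ≤ CD → 0 < cD →
    ∃ A M₁ : ℝ, 0 ≤ A ∧ 0 < M₁ ∧
    ∀ (m K : ℕ) {Mh k R : ℕ} {P' : Fin (d + 1) → ℕ}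
      (hN : ∀ μ, N0 2 Mh k P' μ = (PV d 2 m K hd hL).sitesPerDir 0) (D : B6MultiLevelTorusOperatorL0.TDomains d 2 Mh k P' R) (hk : k ≤ m + K) (_ : 2 ≤ k)
      {a : ℕ} (hMha : Mh = (2 + 1) ^ a) (hM8 : 8 ≤ Mh) (_ : 2 * (2 + 1) ^ 2 ≤ R) (hP6 : ∀ μ, 6 ≤ P' μ)
      (_ : M₁ ≤ (((2 : ℕ) : ℝ) + 1) * Mh) (_ : N₀ + 1 ≤ R * ((2 + 1) * Mh))
      (_ : Real.exp (-(α * σ)) * (((2 : ℕ) : ℝ) + 1) ^ ((2 * (d + 1 : ℕ) : ℝ) / N₀) < 1)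
      {cf : ℝ} (hcf : cf ≠ 0) {w : BondIdx (domT hN D hk) → ℝ} (hw : ∀ i, 0 < w i) (_ : GlobalBand b₀ b₁ cf w)
      (_ : ∀ c : ↥(cubes D.toDomains), HasMajorant (g := geomTB D) (blkV1 hN D)
        (mulOp (zB hN D (one_le_of_eight_le hM8) (four_le_of_five_le (fun μ => le_trans (by norm_num) (hP6 μ))) c) *
          (onFun (dE (P := PV d 2 m K hd hL) cf ∘ₗ (LinearMap.id - RE (domT hN D hk) cf) ∘ₗ dsE cf) -
            Pl hN hk (one_le_of_eight_le hM8) (four_le_of_five_le (fun μ => le_trans (by norm_num) (hP6 μ))) hMha c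
              (band_le (d := d) (ℓ := 2) hb₀ hb₁) (placedC_all_cubes (D := D) rfl hP6 c) w cf) *
          mulOp (hB hN D c))
        (fun y y'' => CD * cf ^ 2 * Real.exp (-(cD * (geomTB D).M)) / (geomTB D).len y ^ 2 * Real.exp (-((2 * σ) * (geomTB D).dist y y'')))),
      HasMajorant (g := geomT D) (blkV1 hN D) (onFun (GE (domT hN D hk) hcf hw))
        (fun y y' => A * pref cf y * Real.exp (-(delta3 α (2 * σ) * (geomT D).dist y y'))) := by
  obtain ⟨σ, hσ, h⟩ := prop26_2136_kLevel_assembly_line3 d 2 hd hL hb₀ hb₁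
  refine ⟨σ, hσ, fun α hα0 hα1 N₀ hN₀ CD cD hCD hcD => ?_⟩
  obtain ⟨A, M₁, hA, hM₁, h2⟩ := h α hα0 hα1 N₀ hN₀ hCD hcD
  refine ⟨A, M₁, hA, hM₁, ?_⟩
  intro m K Mh k R P' hN D hk hk2 a hMha hM8 hR2 hP6 hLM hRM hθ cf hcf w hw hwb hD3
  exact h2 m K hN D hk hk2 hMha hM8 hR2 (fun μ => le_trans (by norm_num) (hP6 μ))  (placedC_all_cubes (D := D) rfl hP6)
    hLM hRM hθ hcf hw hwb hD3

end Line3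

end

end Literature.MathematicalPhysics.QuantumFieldTheory.Balaban1983to89.B6Prop26KLevelAssemblyV1PerCubeL3
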